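import Literature.Barriers.CriticalPhenomena.WeaklySAWQuadraticFlowDeriv
import HarnessLib

/-!
# [BBS-rg-flow, Lemma 2.3, second derivatives, (2.34) for `ḡ` and `z̄`]: `ḡ_j'' = O(ḡ_j²/ḡ₀³)`,
# `z̄_j'' = O(χ_jḡ_j²/ḡ₀³)`

Continuation of `WeaklySAWQuadraticFlowDeriv.lean` (first derivatives `ḡ_j' = gbarDeriv`,
`z̄_j' = zbarDeriv`, `(Π^ζ_{j,l})' = zetaInvProdDeriv`, with (2.33)). Source: Bauerschmidt–Brydges–
Slade, AHP 16 (2015), arXiv:1211.2477, Lemma 2.3: "`V̄_j` … is twice differentiable with respect to the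
initial condition `ḡ₀ > 0`, and … `ḡ_j'' = O(ḡ_j²/ḡ₀³)`, `z̄_j'' = O(χ_jḡ_j²/ḡ₀³)`,
`μ̄_j'' = O(χ_jḡ_j²/ḡ₀³)`", with its proof: "For the second derivative, we use `ḡ₀'' = 0` and
`ḡ_{j+1}'' = ḡ_j''(1 - 2β_jḡ_j) - 2β_jḡ_j'²` to obtain `ḡ_j'' = -2Σ_{l<j}β_lḡ_l'²∏_{k=l}^{j-2}(1 - 2β_kḡ_k)`.
With the bounds of Lemma 2.1, this gives `ḡ_j'' = O(ḡ_j/ḡ₀)²Σ_lβ_lḡ_l²/ḡ₀² = O(ḡ_j²/ḡ₀³)`. …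
Similarly, `σ_{j,l}'' = O(ḡ_j/ḡ₀³)` and `z̄_j'' = Σ_lσ_{j,l}''θ_lḡ_l² + 4Σ_lσ_{j,l}'θ_lḡ_lḡ_l' +
2Σ_lσ_{j,l}θ_l(ḡ_lḡ_l'' + ḡ_l'²) = O(χ_jḡ_j²/ḡ₀³)` using the fact that `ḡ_j³/ḡ₀⁴ = O(ḡ_j²/ḡ₀³)` …
It is straightforward to justify the differentiation under the sum." These second-derivative bounds
are the input of [BBS-rg-flow, Lemma 3.4] and hence of Theorem 1.4(ii) (= BBS 2015, Theorem 7.2.1(ii):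
the flow, in particular the critical initial conditions, is `C¹` in `g₀`).

## What this file proves (explicit constants; `C_{2,0} = (1+N)/c + N + 2Ω/(Ω-1)`)

Under `CutoffQuadHyp P Ω k B c N C lam b` and `8B²C_{2,0}b ≤ 1`:
* `gbarDeriv2` (the printed recursion for `ḡ_j''`), `hasDerivAt_gbarDeriv`, **`abs_gbarDeriv2_le`**:
  `|ḡ_j''| ≤ 8B·C_{2,0}·ḡ_j²/g₀³` — here via the monotone quantity `|ḡ_j''|/ḡ_j²`;
* `zetaLogDeriv2`, `zetaInvProdDeriv2`, `hasDerivAt_zetaLogDeriv`, `hasDerivAt_zetaInvProdDeriv`,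
  `abs_zetaLogDeriv2_le`, `abs_zetaInvProdDeriv2_le` ("`σ_{j,l}'' = O(ḡ_j/ḡ₀³)`");
* `zbarDerivTerm2`, `zbarDeriv2`, `hasDerivAt_zbarDerivTerm`, `abs_zbarDerivTerm2_le`,
  **`hasDerivAt_zbarDeriv`** (termwise differentiation of `z̄_j'`, justified by the M-test) and
  **`abs_zbarDeriv2_le`**: `|z̄_j''| ≤ K_{z,2}χ_jḡ_j²/g₀³`.

Deliberately NOT here: `μ̄_j''` (same method; the `σ_l''`, `τ_i''` bookkeeping is longer).
-/

noncomputable section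

open Filter Topology Set Finset
open scoped BigOperators

namespace Literature.Barriers.CriticalPhenomena

namespace CTWSAW

/-! ### `ḡ_j''` -/

/-- **`ḡ_j''`** by the printed recursion `ḡ₀'' = 0`, `ḡ_{j+1}'' = ḡ_j''(1 - 2β_jḡ_j) - 2β_jḡ_j'²`.
[cite: BauerschmidtBrydgesSlade2015Flow, Lemma 2.3 (proof: "we use ḡ₀'' = 0 and ḡ_{j+1}'' = ḡ_j''(1-2β_jḡ_j) - 2β_jḡ_j'²")] -/
def gbarDeriv2 (β : ℕ → ℝ) (g₀ : ℝ) : ℕ → ℝ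
  | 0 => 0
  | j + 1 => gbarDeriv2 β g₀ j * (1 - 2 * β j * gbar β g₀ j) - 2 * β j * gbarDeriv β g₀ j ^ 2

/-- `ḡ₀'' = 0`. [cite: BauerschmidtBrydgesSlade2015Flow, Lemma 2.3 (proof)] -/
@[simp] theorem gbarDeriv2_zero (β : ℕ → ℝ) (g₀ : ℝ) : gbarDeriv2 β g₀ 0 = 0 := rfl

/-- `ḡ_{j+1}'' = ḡ_j''(1 - 2β_jḡ_j) - 2β_jḡ_j'²`. [cite: BauerschmidtBrydgesSlade2015Flow, Lemma 2.3 (proof)] -/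
theorem gbarDeriv2_succ (β : ℕ → ℝ) (g₀ : ℝ) (j : ℕ) :
    gbarDeriv2 β g₀ (j + 1) = gbarDeriv2 β g₀ j * (1 - 2 * β j * gbar β g₀ j) - 2 * β j * gbarDeriv β g₀ j ^ 2 :=
  rfl

/-- **`ḡ_j'` is differentiable in `g₀` with derivative `ḡ_j''`** (everywhere: the recursion is
polynomial). [cite: BauerschmidtBrydgesSlade2015Flow, Lemma 2.3 ("twice differentiable")] -/
theorem hasDerivAt_gbarDeriv (β : ℕ → ℝ) (j : ℕ) (g : ℝ) :
    HasDerivAt (fun x => gbarDeriv β x j) (gbarDeriv2 β g j) g := by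
  induction j with
  | zero =>
    simp only [gbarDeriv_zero, gbarDeriv2_zero]
    exact hasDerivAt_const g 1
  | succ j ih =>
    have e : (fun x => gbarDeriv β x (j + 1)) = fun x => gbarDeriv β x j * (1 - 2 * β j * gbar β x j) :=
      funext fun x => gbarDeriv_succ β x j
    rw [e]
    have h2 : HasDerivAt (fun x => 1 - 2 * β j * gbar β x j) (-(2 * β j * gbarDeriv β g j)) g :=
      ((hasDerivAt_gbar β j g).const_mul (2 * β j)).const_sub 1
    refine (ih.mul h2).congr_deriv ?_
    rw [gbarDeriv2_succ]
    ring

namespace CutoffGbarHyp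

variable {β : ℕ → ℝ} {Ω : ℝ} {k : ℕ∞} {B c : ℝ} {N : ℕ} {g₀ : ℝ} (h : CutoffGbarHyp β Ω k B c N g₀)
include h

/-- The invariant behind (2.34) for `ḡ`: `|ḡ_j''| ≤ 8g₀⁻⁴(Σ_{l<j}|β_l|ḡ_l²)·ḡ_j²` (the quotient
`|ḡ_j''|/ḡ_j²` increases by at most `8|β_j|ḡ_j²/g₀⁴` per step, since `0 ≤ 1 - 2β_jḡ_j ≤ (1-β_jḡ_j)²`,
`ḡ_j'² ≤ (ḡ_j/g₀)⁴` and `ḡ_j ≤ 2ḡ_{j+1}`). [cite: BauerschmidtBrydgesSlade2015Flow, Lemma 2.3 (proof: ḡ_j'' = O(ḡ_j/ḡ₀)²Σ_lβ_lḡ_l²/ḡ₀²)] -/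
theorem abs_gbarDeriv2_le_sum (hsmall : 8 * B ^ 2 * ((1 + N) / c + N + 2 * Ω / (Ω - 1)) * g₀ ≤ 1) (j : ℕ) :
    |gbarDeriv2 β g₀ j| ≤
      8 * (g₀ ^ 4)⁻¹ * (∑ l ∈ Finset.range j, |β l| * gbar β g₀ l ^ 2) * gbar β g₀ j ^ 2 := by
  have hg := h.g₀_pos
  induction j with
  | zero => simp
  | succ j ih =>
    have hgj := h.gbar_pos j
    have hbh := h.abs_beta_mul_gbar_le_half j
    have hd := h.abs_gbarDeriv_le hsmall j
    have hβg : β j * gbar β g₀ j ≤ 1 / 2 := (le_abs_self _).trans (by rwa [abs_mul, abs_of_pos hgj])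
    have hβg' : -(1 / 2) ≤ β j * gbar β g₀ j := by
      have := neg_abs_le (β j * gbar β g₀ j)
      rw [abs_mul, abs_of_pos hgj] at this
      linarith
    have hF0 : 0 ≤ 1 - 2 * β j * gbar β g₀ j := by linarith
    have hFle : 1 - 2 * β j * gbar β g₀ j ≤ (1 - β j * gbar β g₀ j) ^ 2 := by
      nlinarith [sq_nonneg (β j * gbar β g₀ j)]
    have hsucc : gbar β g₀ (j + 1) = gbar β g₀ j * (1 - β j * gbar β g₀ j) := gbar_succ' β g₀ j
    have hS0 : 0 ≤ ∑ l ∈ Finset.range j, |β l| * gbar β g₀ l ^ 2 :=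
      Finset.sum_nonneg fun l _ => by positivity
    -- the step
    rw [gbarDeriv2_succ, Finset.sum_range_succ]
    refine (abs_sub _ _).trans ?_
    rw [abs_mul, abs_of_nonneg hF0, abs_mul, abs_mul, abs_two, abs_of_nonneg (sq_nonneg (gbarDeriv β g₀ j))]
    have hd2 : gbarDeriv β g₀ j ^ 2 ≤ (gbar β g₀ j / g₀) ^ 4 := by
      have h0 : 0 ≤ |gbarDeriv β g₀ j| := abs_nonneg _
      calc gbarDeriv β g₀ j ^ 2 = |gbarDeriv β g₀ j| ^ 2 := (sq_abs _).symm
        _ ≤ ((gbar β g₀ j / g₀) ^ 2) ^ 2 := pow_le_pow_left₀ h0 hd 2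
        _ = (gbar β g₀ j / g₀) ^ 4 := by ring
    have h43 : gbar β g₀ j ^ 2 ≤ 4 * gbar β g₀ (j + 1) ^ 2 := by
      rw [hsucc]
      have h12 : 1 / 2 ≤ 1 - β j * gbar β g₀ j := by linarith
      nlinarith [sq_nonneg (gbar β g₀ j), mul_pow (gbar β g₀ j) (1 - β j * gbar β g₀ j) 2,
        mul_nonneg (sq_nonneg (gbar β g₀ j)) (by nlinarith : (0 : ℝ) ≤ (1 - β j * gbar β g₀ j) ^ 2 - 1 / 4)]
    have t1 : |gbarDeriv2 β g₀ j| * (1 - 2 * β j * gbar β g₀ j) ≤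
        8 * (g₀ ^ 4)⁻¹ * (∑ l ∈ Finset.range j, |β l| * gbar β g₀ l ^ 2) * gbar β g₀ (j + 1) ^ 2 := by
      calc |gbarDeriv2 β g₀ j| * (1 - 2 * β j * gbar β g₀ j)
          ≤ (8 * (g₀ ^ 4)⁻¹ * (∑ l ∈ Finset.range j, |β l| * gbar β g₀ l ^ 2) * gbar β g₀ j ^ 2) *
              (1 - β j * gbar β g₀ j) ^ 2 := mul_le_mul ih hFle hF0 (by positivity)
        _ = 8 * (g₀ ^ 4)⁻¹ * (∑ l ∈ Finset.range j, |β l| * gbar β g₀ l ^ 2) * gbar β g₀ (j + 1) ^ 2 := by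
            rw [hsucc]; ring
    have t2 : 2 * |β j| * gbarDeriv β g₀ j ^ 2 ≤
        8 * (g₀ ^ 4)⁻¹ * (|β j| * gbar β g₀ j ^ 2) * gbar β g₀ (j + 1) ^ 2 := by
      calc 2 * |β j| * gbarDeriv β g₀ j ^ 2 ≤ 2 * |β j| * (gbar β g₀ j / g₀) ^ 4 := by gcongr
        _ = 2 * (g₀ ^ 4)⁻¹ * (|β j| * gbar β g₀ j ^ 2) * gbar β g₀ j ^ 2 := by
            rw [div_pow]
            ring
        _ ≤ 2 * (g₀ ^ 4)⁻¹ * (|β j| * gbar β g₀ j ^ 2) * (4 * gbar β g₀ (j + 1) ^ 2) := by gcongr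
        _ = _ := by ring
    calc |gbarDeriv2 β g₀ j| * (1 - 2 * β j * gbar β g₀ j) + 2 * |β j| * gbarDeriv β g₀ j ^ 2
        ≤ _ := add_le_add t1 t2
      _ = 8 * (g₀ ^ 4)⁻¹ * (∑ l ∈ Finset.range j, |β l| * gbar β g₀ l ^ 2 + |β j| * gbar β g₀ j ^ 2) *
            gbar β g₀ (j + 1) ^ 2 := by ring

/-- **[BBS-rg-flow, Lemma 2.3, (2.34) for `ḡ`]: `|ḡ_j''| ≤ 8B·C_{2,0}·ḡ_j²/g₀³`** (from
`Σ_l|β_l|ḡ_l² ≤ B·C_{2,0}g₀`). [cite: BauerschmidtBrydgesSlade2015Flow, Lemma 2.3, (2.34) (ḡ_j'' = O(ḡ_j²/ḡ₀³))] -/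
theorem abs_gbarDeriv2_le (hsmall : 8 * B ^ 2 * ((1 + N) / c + N + 2 * Ω / (Ω - 1)) * g₀ ≤ 1) (j : ℕ) :
    |gbarDeriv2 β g₀ j| ≤ 8 * B * ((1 + N) / c + N + 2 * Ω / (Ω - 1)) * gbar β g₀ j ^ 2 / g₀ ^ 3 := by
  have hg := h.g₀_pos
  have hB := h.B_nonneg
  have hS : ∑ l ∈ Finset.range j, |β l| * gbar β g₀ l ^ 2 ≤ B * ((1 + N) / c + N + 2 * Ω / (Ω - 1)) * g₀ := by
    rcases Nat.eq_zero_or_pos j with hj | hj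
    · subst hj; simp; exact mul_nonneg (mul_nonneg hB h.C20_nonneg) hg.le
    · calc ∑ l ∈ Finset.range j, |β l| * gbar β g₀ l ^ 2
          ≤ ∑ l ∈ Finset.range j, B * (cutoffWeight Ω k l * gbar β g₀ l ^ 2) :=
            Finset.sum_le_sum fun l _ => by
              calc |β l| * gbar β g₀ l ^ 2 ≤ B * cutoffWeight Ω k l * gbar β g₀ l ^ 2 :=
                    mul_le_mul_of_nonneg_right (h.abs_le l) (sq_nonneg _)
                _ = _ := by ring
        _ = B * ∑ l ∈ Finset.Icc 0 (j - 1), cutoffWeight Ω k l * gbar β g₀ l ^ 2 := by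
            rw [← Finset.mul_sum]; congr 1
            rw [Finset.range_eq_Ico, show j = j - 1 + 1 by omega, Finset.Ico_add_one_right_eq_Icc]
            rfl
        _ ≤ B * (((1 + N) / c + N + 2 * Ω / (Ω - 1)) * (cutoffWeight Ω k 0 * gbar β g₀ 0)) :=
            mul_le_mul_of_nonneg_left (h.sum_weight_mul_gbar_sq_le 0 (j - 1)) hB
        _ ≤ B * (((1 + N) / c + N + 2 * Ω / (Ω - 1)) * (1 * g₀)) := by
            have h0 : cutoffWeight Ω k 0 * gbar β g₀ 0 ≤ 1 * g₀ :=
              mul_le_mul (h.weight_le_one 0) (by simp) (by simp [hg.le]) zero_le_one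
            exact mul_le_mul_of_nonneg_left (mul_le_mul_of_nonneg_left h0 h.C20_nonneg) hB
        _ = _ := by ring
  calc |gbarDeriv2 β g₀ j| ≤ 8 * (g₀ ^ 4)⁻¹ * (∑ l ∈ Finset.range j, |β l| * gbar β g₀ l ^ 2) * gbar β g₀ j ^ 2 :=
        h.abs_gbarDeriv2_le_sum hsmall j
    _ ≤ 8 * (g₀ ^ 4)⁻¹ * (B * ((1 + N) / c + N + 2 * Ω / (Ω - 1)) * g₀) * gbar β g₀ j ^ 2 := by gcongr
    _ = _ := by field_simp

end CutoffGbarHyp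

/-! ### Constants of the second-derivative bounds -/

/-- `K_{S'} = C·C_{2,0}·(16B·C_{2,0} + 4C)`, the constant of `|(Σ^ζ)'| ≤ K_{S'}χ_jḡ_j/g₀³`. [cite: BauerschmidtBrydgesSlade2015Flow, Lemma 2.3 (proof, σ_{j,l}'')] -/
def zetaLogDeriv2Const (B C c20 : ℝ) : ℝ := C * c20 * (16 * B * c20 + 4 * C)

/-- `K_{Z''} = 16C²C_{2,0}² + 2K_{S'}`, the constant of `|(Π^ζ)''| ≤ K_{Z''}χ_jḡ_j/g₀³`. [cite: BauerschmidtBrydgesSlade2015Flow, Lemma 2.3 (proof, σ_{j,l}'' = O(ḡ_j/ḡ₀³))] -/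
def zetaInvProdDeriv2Const (B C c20 : ℝ) : ℝ := 16 * C ^ 2 * c20 ^ 2 + 2 * zetaLogDeriv2Const B C c20

/-- The `χ_jḡ_j·χ_lḡ_l²`-coefficient of the termwise bound for `z̄_j''`. [cite: BauerschmidtBrydgesSlade2015Flow, Lemma 2.3, (zbarprimeprime)] -/
def zbarTerm2ConstA (B C c20 : ℝ) : ℝ := zetaInvProdDeriv2Const B C c20 * C + 32 * C ^ 2 * c20

/-- The `χ_lḡ_l³`-coefficient of the termwise bound for `z̄_j''`. [cite: BauerschmidtBrydgesSlade2015Flow, Lemma 2.3, (zbarprimeprime)] -/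
def zbarTerm2ConstA' (B C c20 : ℝ) : ℝ := C * (8 + 32 * B * c20)

/-- `K_{z,2} = A·C_{2,0} + 2A'·C_{2,0}`, the constant of `|z̄_j''| ≤ K_{z,2}χ_jḡ_j²/g₀³`. [cite: BauerschmidtBrydgesSlade2015Flow, Lemma 2.3, (2.34)] -/
def zbarDeriv2Const (B C c20 : ℝ) : ℝ := zbarTerm2ConstA B C c20 * c20 + 2 * zbarTerm2ConstA' B C c20 * c20

/-- `K_{S'} ≥ 0`. [folklore] -/
theorem zetaLogDeriv2Const_nonneg {B C c20 : ℝ} (hB : 0 ≤ B) (hC : 0 ≤ C) (hc : 0 ≤ c20) :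
    0 ≤ zetaLogDeriv2Const B C c20 := by unfold zetaLogDeriv2Const; positivity

/-- `K_{Z''} ≥ 0`. [folklore] -/
theorem zetaInvProdDeriv2Const_nonneg {B C c20 : ℝ} (hB : 0 ≤ B) (hC : 0 ≤ C) (hc : 0 ≤ c20) :
    0 ≤ zetaInvProdDeriv2Const B C c20 := by
  have := zetaLogDeriv2Const_nonneg hB hC hc
  unfold zetaInvProdDeriv2Const; positivity

/-- `A ≥ 0`. [folklore] -/
theorem zbarTerm2ConstA_nonneg {B C c20 : ℝ} (hB : 0 ≤ B) (hC : 0 ≤ C) (hc : 0 ≤ c20) :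
    0 ≤ zbarTerm2ConstA B C c20 := by
  have := zetaInvProdDeriv2Const_nonneg hB hC hc
  unfold zbarTerm2ConstA; positivity

/-- `A' ≥ 0`. [folklore] -/
theorem zbarTerm2ConstA'_nonneg {B C c20 : ℝ} (hB : 0 ≤ B) (hC : 0 ≤ C) (hc : 0 ≤ c20) :
    0 ≤ zbarTerm2ConstA' B C c20 := by unfold zbarTerm2ConstA'; positivity

/-- `K_{z,2} ≥ 0`. [folklore] -/
theorem zbarDeriv2Const_nonneg {B C c20 : ℝ} (hB : 0 ≤ B) (hC : 0 ≤ C) (hc : 0 ≤ c20) :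
    0 ≤ zbarDeriv2Const B C c20 := by
  have := zbarTerm2ConstA_nonneg hB hC hc
  have := zbarTerm2ConstA'_nonneg hB hC hc
  unfold zbarDeriv2Const; positivity

/-! ### `(Π^ζ_{j,l})''` -/

namespace QuadFlowParams

variable (P : QuadFlowParams) (g₀ : ℝ)

/-- The derivative of `Σ^ζ_{j,l}`: `Σ_i ζ_{i+j}(ḡ_{i+j}''f_{i+j} + ḡ_{i+j}'·ζ_{i+j}ḡ_{i+j}'f_{i+j}²)`,
`f = (1 - ζḡ)⁻¹`. [cite: BauerschmidtBrydgesSlade2015Flow, Lemma 2.3 (proof: σ_{j,l}'' = O(ḡ_j/ḡ₀³))] -/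
def zetaLogDeriv2 (j l : ℕ) : ℝ :=
  ∑ i ∈ Finset.range (l + 1), P.ζ (i + j) *
    (gbarDeriv2 P.β g₀ (i + j) * (1 - P.ζ (i + j) * gbar P.β g₀ (i + j))⁻¹ +
      gbarDeriv P.β g₀ (i + j) *
        (P.ζ (i + j) * gbarDeriv P.β g₀ (i + j) * (1 - P.ζ (i + j) * gbar P.β g₀ (i + j))⁻¹ ^ 2))

/-- `(Π^ζ_{j,l})'' = (Π^ζ)'·Σ^ζ + Π^ζ·(Σ^ζ)'`. [cite: BauerschmidtBrydgesSlade2015Flow, Lemma 2.3 (proof, σ_{j,l}'')] -/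
def zetaInvProdDeriv2 (j l : ℕ) : ℝ :=
  P.zetaInvProdDeriv g₀ j l * P.zetaLogDeriv g₀ j l + P.zetaInvProd g₀ j l * P.zetaLogDeriv2 g₀ j l

/-- The second termwise derivative of (2.14):
`(Π^ζ)''θḡ² + (Π^ζ)'θ·2ḡḡ' + ((Π^ζ)'θ·2ḡḡ' + Π^ζθ(2ḡ'ḡ' + 2ḡḡ''))`.
[cite: BauerschmidtBrydgesSlade2015Flow, Lemma 2.3, (zbarprimeprime)] -/
def zbarDerivTerm2 (j l : ℕ) : ℝ :=
  P.zetaInvProdDeriv2 g₀ j l * (P.θ (l + j) * gbar P.β g₀ (l + j) ^ 2) +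
      P.zetaInvProdDeriv g₀ j l * (P.θ (l + j) * (2 * gbar P.β g₀ (l + j) * gbarDeriv P.β g₀ (l + j))) +
    (P.zetaInvProdDeriv g₀ j l * (P.θ (l + j) * (2 * gbar P.β g₀ (l + j) * gbarDeriv P.β g₀ (l + j))) +
      P.zetaInvProd g₀ j l * (P.θ (l + j) *
        (2 * gbarDeriv P.β g₀ (l + j) * gbarDeriv P.β g₀ (l + j) +
          2 * gbar P.β g₀ (l + j) * gbarDeriv2 P.β g₀ (l + j))))

/-- **`z̄_j'' = Σ_l(Π^ζ)''θḡ² + 4Σ_l(Π^ζ)'θḡḡ' + 2Σ_lΠ^ζθ(ḡḡ'' + ḡ'²)`** (the derivative of `z̄_j'`).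
[cite: BauerschmidtBrydgesSlade2015Flow, Lemma 2.3, (zbarprimeprime)] -/
def zbarDeriv2 (j : ℕ) : ℝ := ∑' l, P.zbarDerivTerm2 g₀ j l

end QuadFlowParams

section

variable {P : QuadFlowParams} {Ω : ℝ} {k : ℕ∞} {B c : ℝ} {N : ℕ} {C lam b : ℝ}

/-- `Σ^ζ_{j,l}` is differentiable in `g₀` with derivative `zetaLogDeriv2` (where the factors are
nonzero). [cite: BauerschmidtBrydgesSlade2015Flow, Lemma 2.3 (proof, σ_{j,l}'')] -/
theorem hasDerivAt_zetaLogDeriv (P : QuadFlowParams) {g : ℝ} (hne : ∀ n, 1 - P.ζ n * gbar P.β g n ≠ 0)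
    (j l : ℕ) : HasDerivAt (fun x => P.zetaLogDeriv x j l) (P.zetaLogDeriv2 g j l) g := by
  unfold QuadFlowParams.zetaLogDeriv QuadFlowParams.zetaLogDeriv2
  refine HasDerivAt.fun_sum fun i _ => ?_
  have hD := hasDerivAt_gbarDeriv P.β (i + j) g
  have hf := hasDerivAt_inv_one_sub_zeta_mul_gbar P (i + j) g (hne (i + j))
  exact ((hD.const_mul (P.ζ (i + j))).mul hf).congr_deriv (by ring)

/-- `(Π^ζ_{j,l})'` is differentiable in `g₀` with derivative `zetaInvProdDeriv2`.
[cite: BauerschmidtBrydgesSlade2015Flow, Lemma 2.3 (proof, σ_{j,l}'')] -/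
theorem hasDerivAt_zetaInvProdDeriv (P : QuadFlowParams) {g : ℝ} (hne : ∀ n, 1 - P.ζ n * gbar P.β g n ≠ 0)
    (j l : ℕ) : HasDerivAt (fun x => P.zetaInvProdDeriv x j l) (P.zetaInvProdDeriv2 g j l) g := by
  unfold QuadFlowParams.zetaInvProdDeriv QuadFlowParams.zetaInvProdDeriv2
  exact (hasDerivAt_zetaInvProd P hne j l).mul (hasDerivAt_zetaLogDeriv P hne j l)

/-- The termwise derivative `zbarDerivTerm` of (2.14) is itself differentiable in `g₀`, with
derivative `zbarDerivTerm2`. [cite: BauerschmidtBrydgesSlade2015Flow, Lemma 2.3, (zbarprimeprime)] -/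
theorem hasDerivAt_zbarDerivTerm (P : QuadFlowParams) {g : ℝ} (hne : ∀ n, 1 - P.ζ n * gbar P.β g n ≠ 0)
    (j l : ℕ) : HasDerivAt (fun x => P.zbarDerivTerm x j l) (P.zbarDerivTerm2 g j l) g := by
  have h1 := hasDerivAt_zetaInvProdDeriv P hne j l
  have h2 : HasDerivAt (fun x => P.θ (l + j) * gbar P.β x (l + j) ^ 2)
      (P.θ (l + j) * (2 * gbar P.β g (l + j) * gbarDeriv P.β g (l + j))) g := by
    refine (((hasDerivAt_gbar P.β (l + j) g).fun_pow 2).const_mul (P.θ (l + j))).congr_deriv ?_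
    norm_num
  have h3 := hasDerivAt_zetaInvProd P hne j l
  have h4 : HasDerivAt (fun x => P.θ (l + j) * (2 * gbar P.β x (l + j) * gbarDeriv P.β x (l + j)))
      (P.θ (l + j) * (2 * gbarDeriv P.β g (l + j) * gbarDeriv P.β g (l + j) +
        2 * gbar P.β g (l + j) * gbarDeriv2 P.β g (l + j))) g :=
    (((hasDerivAt_gbar P.β (l + j) g).const_mul 2).mul (hasDerivAt_gbarDeriv P.β (l + j) g)).const_mul _
  unfold QuadFlowParams.zbarDerivTerm QuadFlowParams.zbarDerivTerm2
  exact (h1.mul h2).add (h3.mul h4)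

/-! #### Bounds at a point -/

namespace CutoffQuadHyp

variable {g₀ : ℝ} (h : CutoffQuadHyp P Ω k B c N C lam g₀)
include h

/-- **`|(Σ^ζ_{j,l})'| ≤ K_{S'}χ_jḡ_j/g₀³`**. [cite: BauerschmidtBrydgesSlade2015Flow, Lemma 2.3 (proof: σ_{j,l}'' = O(ḡ_j/ḡ₀³))] -/
theorem abs_zetaLogDeriv2_le (hsmall : 8 * B ^ 2 * ((1 + N) / c + N + 2 * Ω / (Ω - 1)) * g₀ ≤ 1) (j l : ℕ) :
    |P.zetaLogDeriv2 g₀ j l| ≤ zetaLogDeriv2Const B C ((1 + N) / c + N + 2 * Ω / (Ω - 1)) *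
      (cutoffWeight Ω k j * gbar P.β g₀ j) / g₀ ^ 3 := by
  have hG := h.toCutoffGbarHyp
  have hg := hG.g₀_pos
  have hC := h.C_nonneg
  have hB := hG.B_nonneg
  have hC20 := hG.C20_nonneg
  have hsumsq := hG.sum_weight_mul_gbar_sq_le j (j + l)
  set c20 : ℝ := (1 + N) / c + N + 2 * Ω / (Ω - 1) with hc20
  have hterm : ∀ i, |P.ζ (i + j) * (gbarDeriv2 P.β g₀ (i + j) * (1 - P.ζ (i + j) * gbar P.β g₀ (i + j))⁻¹ +
      gbarDeriv P.β g₀ (i + j) * (P.ζ (i + j) * gbarDeriv P.β g₀ (i + j) *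
        (1 - P.ζ (i + j) * gbar P.β g₀ (i + j))⁻¹ ^ 2))| ≤
      C * (16 * B * c20 + 4 * C) / g₀ ^ 3 * (cutoffWeight Ω k (i + j) * gbar P.β g₀ (i + j) ^ 2) := by
    intro i
    have hz := h.zeta_le (i + j)
    have hw := (hG.weight_pos (i + j)).le
    have hw1 := hG.weight_le_one (i + j)
    have hgn := (hG.gbar_pos (i + j)).le
    have hgn2 := hG.gbar_le_two_mul_init (i + j)
    have hg12 := hG.gbar_le_half (i + j)
    have hd := hG.abs_gbarDeriv_le hsmall (i + j)
    have hE := hG.abs_gbarDeriv2_le hsmall (i + j)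
    obtain ⟨hf0, hf2⟩ := h.inv_one_sub_zeta_mul_gbar_mem (i + j)
    have hd' : |gbarDeriv P.β g₀ (i + j)| ≤ gbar P.β g₀ (i + j) ^ 2 / g₀ ^ 2 := by rwa [div_pow] at hd
    have hzC : |P.ζ (i + j)| ≤ C := hz.trans (mul_le_of_le_one_right hC hw1)
    -- the two summands
    have t1 : |gbarDeriv2 P.β g₀ (i + j) * (1 - P.ζ (i + j) * gbar P.β g₀ (i + j))⁻¹| ≤
        (8 * B * c20 * gbar P.β g₀ (i + j) ^ 2 / g₀ ^ 3) * 2 := by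
      rw [abs_mul, abs_of_nonneg hf0]
      exact mul_le_mul hE hf2 hf0 (by positivity)
    have t2 : |gbarDeriv P.β g₀ (i + j) * (P.ζ (i + j) * gbarDeriv P.β g₀ (i + j) *
        (1 - P.ζ (i + j) * gbar P.β g₀ (i + j))⁻¹ ^ 2)| ≤
        (gbar P.β g₀ (i + j) ^ 2 / g₀ ^ 2) * (C * (gbar P.β g₀ (i + j) ^ 2 / g₀ ^ 2) * 2 ^ 2) := by
      rw [abs_mul, abs_mul, abs_mul, abs_pow, abs_of_nonneg hf0]
      exact mul_le_mul hd' (mul_le_mul (mul_le_mul hzC hd' (abs_nonneg _) hC)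
        (pow_le_pow_left₀ hf0 hf2 2) (by positivity) (by positivity)) (by positivity) (by positivity)
    have hsq : gbar P.β g₀ (i + j) ^ 2 ≤ g₀ := by nlinarith
    rw [abs_mul]
    calc |P.ζ (i + j)| * |gbarDeriv2 P.β g₀ (i + j) * (1 - P.ζ (i + j) * gbar P.β g₀ (i + j))⁻¹ +
          gbarDeriv P.β g₀ (i + j) * (P.ζ (i + j) * gbarDeriv P.β g₀ (i + j) *
            (1 - P.ζ (i + j) * gbar P.β g₀ (i + j))⁻¹ ^ 2)|
        ≤ (C * cutoffWeight Ω k (i + j)) * ((8 * B * c20 * gbar P.β g₀ (i + j) ^ 2 / g₀ ^ 3) * 2 +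
            (gbar P.β g₀ (i + j) ^ 2 / g₀ ^ 2) * (C * (gbar P.β g₀ (i + j) ^ 2 / g₀ ^ 2) * 2 ^ 2)) :=
          mul_le_mul hz ((abs_add_le _ _).trans (add_le_add t1 t2)) (abs_nonneg _) (mul_nonneg hC hw)
      _ = C * (16 * B * c20 + 4 * C * (gbar P.β g₀ (i + j) ^ 2 / g₀)) / g₀ ^ 3 *
            (cutoffWeight Ω k (i + j) * gbar P.β g₀ (i + j) ^ 2) := by
          field_simp
          ring
      _ ≤ C * (16 * B * c20 + 4 * C * 1) / g₀ ^ 3 * (cutoffWeight Ω k (i + j) * gbar P.β g₀ (i + j) ^ 2) := by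
          have hx : gbar P.β g₀ (i + j) ^ 2 / g₀ ≤ 1 := by rwa [div_le_one hg]
          gcongr
      _ = _ := by ring
  unfold QuadFlowParams.zetaLogDeriv2
  calc |∑ i ∈ Finset.range (l + 1), P.ζ (i + j) * (gbarDeriv2 P.β g₀ (i + j) * (1 - P.ζ (i + j) * gbar P.β g₀ (i + j))⁻¹ +
        gbarDeriv P.β g₀ (i + j) * (P.ζ (i + j) * gbarDeriv P.β g₀ (i + j) *
          (1 - P.ζ (i + j) * gbar P.β g₀ (i + j))⁻¹ ^ 2))|
      ≤ ∑ i ∈ Finset.range (l + 1), |P.ζ (i + j) * (gbarDeriv2 P.β g₀ (i + j) * (1 - P.ζ (i + j) * gbar P.β g₀ (i + j))⁻¹ +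
        gbarDeriv P.β g₀ (i + j) * (P.ζ (i + j) * gbarDeriv P.β g₀ (i + j) *
          (1 - P.ζ (i + j) * gbar P.β g₀ (i + j))⁻¹ ^ 2))| := Finset.abs_sum_le_sum_abs _ _
    _ ≤ ∑ i ∈ Finset.range (l + 1), C * (16 * B * c20 + 4 * C) / g₀ ^ 3 *
          (cutoffWeight Ω k (i + j) * gbar P.β g₀ (i + j) ^ 2) := Finset.sum_le_sum fun i _ => hterm i
    _ = C * (16 * B * c20 + 4 * C) / g₀ ^ 3 *
          ∑ m ∈ Finset.Icc j (j + l), cutoffWeight Ω k m * gbar P.β g₀ m ^ 2 := by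
        rw [← Finset.mul_sum, sum_range_shift_eq_sum_Icc (fun m => cutoffWeight Ω k m * gbar P.β g₀ m ^ 2)]
    _ ≤ C * (16 * B * c20 + 4 * C) / g₀ ^ 3 * (c20 * (cutoffWeight Ω k j * gbar P.β g₀ j)) :=
        mul_le_mul_of_nonneg_left hsumsq (by positivity)
    _ = _ := by rw [zetaLogDeriv2Const]; ring

/-- **`|(Π^ζ_{j,l})''| ≤ K_{Z''}χ_jḡ_j/g₀³`** ("`σ_{j,l}'' = O(ḡ_j/ḡ₀³)`").
[cite: BauerschmidtBrydgesSlade2015Flow, Lemma 2.3 (proof: "Similarly, σ_{j,l}'' = O(ḡ_j/ḡ₀³)")] -/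
theorem abs_zetaInvProdDeriv2_le (hsmall : 8 * B ^ 2 * ((1 + N) / c + N + 2 * Ω / (Ω - 1)) * g₀ ≤ 1) (j l : ℕ) :
    |P.zetaInvProdDeriv2 g₀ j l| ≤ zetaInvProdDeriv2Const B C ((1 + N) / c + N + 2 * Ω / (Ω - 1)) *
      (cutoffWeight Ω k j * gbar P.β g₀ j) / g₀ ^ 3 := by
  have hG := h.toCutoffGbarHyp
  have hg := hG.g₀_pos
  have hC := h.C_nonneg
  have hB := hG.B_nonneg
  have hC20 := hG.C20_nonneg
  have hZ' := h.abs_zetaInvProdDeriv_le hsmall j l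
  have hS := h.abs_zetaLogDeriv_le hsmall j l
  have hS' := h.abs_zetaLogDeriv2_le hsmall j l
  obtain ⟨hP0, hP2⟩ := h.zetaInvProd_mem j l
  have hwj := (hG.weight_pos j).le
  have hwj1 := hG.weight_le_one j
  have hgj := (hG.gbar_pos j).le
  have hgj2 := hG.gbar_le_two_mul_init j
  set c20 : ℝ := (1 + N) / c + N + 2 * Ω / (Ω - 1) with hc20
  set X : ℝ := cutoffWeight Ω k j * gbar P.β g₀ j with hX
  have hX0 : 0 ≤ X := by positivity
  have hXg : X ≤ 2 * g₀ := by
    calc X ≤ 1 * (2 * g₀) := mul_le_mul hwj1 hgj2 hgj zero_le_one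
      _ = 2 * g₀ := one_mul _
  have hK := zetaLogDeriv2Const_nonneg hB hC hC20
  unfold QuadFlowParams.zetaInvProdDeriv2
  refine (abs_add_le _ _).trans ?_
  rw [abs_mul, abs_mul, abs_of_nonneg hP0]
  have t1 : |P.zetaInvProdDeriv g₀ j l| * |P.zetaLogDeriv g₀ j l| ≤
      (4 * C * c20 * X / g₀ ^ 2) * (2 * C * c20 * X / g₀ ^ 2) :=
    mul_le_mul hZ' hS (abs_nonneg _) (by positivity)
  have t2 : P.zetaInvProd g₀ j l * |P.zetaLogDeriv2 g₀ j l| ≤ 2 * (zetaLogDeriv2Const B C c20 * X / g₀ ^ 3) :=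
    mul_le_mul hP2 hS' (abs_nonneg _) zero_le_two
  refine (add_le_add t1 t2).trans ?_
  have e : (4 * C * c20 * X / g₀ ^ 2) * (2 * C * c20 * X / g₀ ^ 2) + 2 * (zetaLogDeriv2Const B C c20 * X / g₀ ^ 3) =
      (8 * C ^ 2 * c20 ^ 2 * (X / g₀) + 2 * zetaLogDeriv2Const B C c20) * X / g₀ ^ 3 := by
    field_simp
    ring
  rw [e, zetaInvProdDeriv2Const]
  refine div_le_div_of_nonneg_right (mul_le_mul_of_nonneg_right ?_ hX0) (by positivity)
  have hx : X / g₀ ≤ 2 := by rw [div_le_iff₀ hg]; linarith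
  nlinarith [mul_nonneg (by positivity : (0 : ℝ) ≤ 8 * C ^ 2 * c20 ^ 2) (sub_nonneg.2 hx)]

/-- **Termwise bound for `z̄_j''`**: `|zbarDerivTerm2| ≤ (A·χ_jḡ_j·χ_{l+j}ḡ_{l+j}² + A'·χ_{l+j}ḡ_{l+j}³)/g₀³`.
[cite: BauerschmidtBrydgesSlade2015Flow, Lemma 2.3, (zbarprimeprime)] -/
theorem abs_zbarDerivTerm2_le (hsmall : 8 * B ^ 2 * ((1 + N) / c + N + 2 * Ω / (Ω - 1)) * g₀ ≤ 1) (j l : ℕ) :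
    |P.zbarDerivTerm2 g₀ j l| ≤
      (zbarTerm2ConstA B C ((1 + N) / c + N + 2 * Ω / (Ω - 1)) *
          (cutoffWeight Ω k j * gbar P.β g₀ j) * (cutoffWeight Ω k (l + j) * gbar P.β g₀ (l + j) ^ 2) +
        zbarTerm2ConstA' B C ((1 + N) / c + N + 2 * Ω / (Ω - 1)) *
          (cutoffWeight Ω k (l + j) * gbar P.β g₀ (l + j) ^ 3)) / g₀ ^ 3 := by
  have hG := h.toCutoffGbarHyp
  have hg := hG.g₀_pos
  have hC := h.C_nonneg
  have hB := hG.B_nonneg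
  have hC20 := hG.C20_nonneg
  have hZ'' := h.abs_zetaInvProdDeriv2_le hsmall j l
  have hZ' := h.abs_zetaInvProdDeriv_le hsmall j l
  obtain ⟨hP0, hP2⟩ := h.zetaInvProd_mem j l
  have hθ := h.theta_le (l + j)
  have hd := hG.abs_gbarDeriv_le hsmall (l + j)
  have hE := hG.abs_gbarDeriv2_le hsmall (l + j)
  have hwj := (hG.weight_pos j).le
  have hwn := (hG.weight_pos (l + j)).le
  have hgj := (hG.gbar_pos j).le
  have hgn := (hG.gbar_pos (l + j)).le
  have hgn2 := hG.gbar_le_two_mul_init (l + j)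
  set c20 : ℝ := (1 + N) / c + N + 2 * Ω / (Ω - 1) with hc20
  set KZ2 : ℝ := zetaInvProdDeriv2Const B C c20 with hKZ2
  have hKZ2_0 : 0 ≤ KZ2 := zetaInvProdDeriv2Const_nonneg hB hC hC20
  set Xj : ℝ := cutoffWeight Ω k j * gbar P.β g₀ j with hXj
  have hXj0 : 0 ≤ Xj := by positivity
  set gn : ℝ := gbar P.β g₀ (l + j) with hgn_def
  set wn : ℝ := cutoffWeight Ω k (l + j) with hwn_def
  have hd' : |gbarDeriv P.β g₀ (l + j)| ≤ gn ^ 2 / g₀ ^ 2 := by rwa [div_pow] at hd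
  have hgn' : gn / g₀ ≤ 2 := by rw [div_le_iff₀ hg]; linarith
  -- the four products
  have t1 : |P.zetaInvProdDeriv2 g₀ j l * (P.θ (l + j) * gn ^ 2)| ≤ (KZ2 * Xj / g₀ ^ 3) * ((C * wn) * gn ^ 2) := by
    rw [abs_mul, abs_mul, abs_of_nonneg (sq_nonneg gn)]
    exact mul_le_mul hZ'' (mul_le_mul_of_nonneg_right hθ (sq_nonneg _)) (by positivity) ((abs_nonneg _).trans hZ'')
  have t2 : |P.zetaInvProdDeriv g₀ j l * (P.θ (l + j) * (2 * gn * gbarDeriv P.β g₀ (l + j)))| ≤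
      (4 * C * c20 * Xj / g₀ ^ 2) * ((C * wn) * (2 * gn * (gn ^ 2 / g₀ ^ 2))) := by
    rw [abs_mul, abs_mul, abs_mul, abs_of_nonneg (by positivity : (0 : ℝ) ≤ 2 * gn)]
    exact mul_le_mul hZ' (mul_le_mul hθ (mul_le_mul_of_nonneg_left hd' (by positivity)) (by positivity)
      (mul_nonneg hC hwn)) (by positivity) ((abs_nonneg _).trans hZ')
  have t4 : |P.zetaInvProd g₀ j l * (P.θ (l + j) * (2 * gbarDeriv P.β g₀ (l + j) * gbarDeriv P.β g₀ (l + j) +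
      2 * gn * gbarDeriv2 P.β g₀ (l + j)))| ≤
      2 * ((C * wn) * (2 * (gn ^ 2 / g₀ ^ 2) * (gn ^ 2 / g₀ ^ 2) + 2 * gn * (8 * B * c20 * gn ^ 2 / g₀ ^ 3))) := by
    rw [abs_mul, abs_of_nonneg hP0, abs_mul]
    refine mul_le_mul hP2 (mul_le_mul hθ ?_ (abs_nonneg _) (mul_nonneg hC hwn)) (by positivity) zero_le_two
    refine (abs_add_le _ _).trans (add_le_add ?_ ?_)
    · rw [abs_mul, abs_mul, abs_two]
      exact mul_le_mul (mul_le_mul_of_nonneg_left hd' zero_le_two) hd' (abs_nonneg _) (by positivity)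
    · rw [abs_mul, abs_mul, abs_two, abs_of_nonneg hgn]
      exact mul_le_mul_of_nonneg_left hE (by positivity)
  unfold QuadFlowParams.zbarDerivTerm2
  refine (abs_add_le _ _).trans ?_
  refine (add_le_add ((abs_add_le _ _).trans (add_le_add t1 t2)) ((abs_add_le _ _).trans (add_le_add t2 t4))).trans ?_
  -- algebra: collect, then `gn/g₀ ≤ 2`
  have e : (KZ2 * Xj / g₀ ^ 3) * ((C * wn) * gn ^ 2) +
      (4 * C * c20 * Xj / g₀ ^ 2) * ((C * wn) * (2 * gn * (gn ^ 2 / g₀ ^ 2))) +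
      ((4 * C * c20 * Xj / g₀ ^ 2) * ((C * wn) * (2 * gn * (gn ^ 2 / g₀ ^ 2))) +
      2 * ((C * wn) * (2 * (gn ^ 2 / g₀ ^ 2) * (gn ^ 2 / g₀ ^ 2) + 2 * gn * (8 * B * c20 * gn ^ 2 / g₀ ^ 3)))) =
      ((KZ2 * C + 16 * C ^ 2 * c20 * (gn / g₀)) * Xj * (wn * gn ^ 2) +
        C * (4 * (gn / g₀) + 32 * B * c20) * (wn * gn ^ 3)) / g₀ ^ 3 := by
    field_simp
    ring
  rw [e, zbarTerm2ConstA, zbarTerm2ConstA', ← hKZ2]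
  refine div_le_div_of_nonneg_right (add_le_add ?_ ?_) (by positivity)
  · refine mul_le_mul_of_nonneg_right (mul_le_mul_of_nonneg_right ?_ hXj0) (by positivity)
    nlinarith [mul_nonneg (by positivity : (0 : ℝ) ≤ 16 * C ^ 2 * c20) (sub_nonneg.2 hgn')]
  · refine mul_le_mul_of_nonneg_right (mul_le_mul_of_nonneg_left ?_ hC) (by positivity)
    linarith

end CutoffQuadHyp

/-! ### `z̄_j'` is differentiable, `|z̄_j''| ≤ K_{z,2}χ_jḡ_j²/g₀³` -/

/-- The numerator of the termwise majorant, monotone in the data. [folklore] -/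
theorem zbarMajorant2_mono {A A' wj wl gj gl gj' gl' : ℝ} (hA : 0 ≤ A) (hA' : 0 ≤ A') (hwj : 0 ≤ wj)
    (hwl : 0 ≤ wl) (hgj : 0 ≤ gj) (hgl : 0 ≤ gl) (hj : gj ≤ gj') (hl : gl ≤ gl') :
    A * (wj * gj) * (wl * gl ^ 2) + A' * (wl * gl ^ 3) ≤ A * (wj * gj') * (wl * gl' ^ 2) + A' * (wl * gl' ^ 3) := by
  have hgj' : 0 ≤ gj' := hgj.trans hj
  have hgl' : 0 ≤ gl' := hgl.trans hl
  gcongr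

/-- **[BBS-rg-flow, Lemma 2.3] for `z̄`, second derivative: `z̄_j'` is differentiable in the initial
condition**, with derivative `zbarDeriv2` (termwise differentiation, justified by the M-test with
`g₀`-uniform majorants on `(g₀/2, b)`), for `g₀ ∈ (0,b)`.
[cite: BauerschmidtBrydgesSlade2015Flow, Lemma 2.3 ("twice differentiable"; "It is straightforward to justify the differentiation under the sum in (zbarprime)–(zbarprimeprime)")] -/
theorem hasDerivAt_zbarDeriv (hb : CutoffQuadHyp P Ω k B c N C lam b)
    (hsmall : 8 * B ^ 2 * ((1 + N) / c + N + 2 * Ω / (Ω - 1)) * b ≤ 1) {g : ℝ} (hg : 0 < g)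
    (hgb : g < b) (j : ℕ) : HasDerivAt (fun x => P.zbarDeriv x j) (P.zbarDeriv2 g j) g := by
  have hGb := hb.toCutoffGbarHyp
  have hC := hb.C_nonneg
  have hB := hGb.B_nonneg
  have hC20 := hGb.C20_nonneg
  have ha0 : 0 < g / 2 := by positivity
  have hsm : ∀ x : ℝ, x ≤ b → 8 * B ^ 2 * ((1 + N) / c + N + 2 * Ω / (Ω - 1)) * x ≤ 1 := fun x hx =>
    le_trans (mul_le_mul_of_nonneg_left hx (mul_nonneg (by positivity) hC20)) hsmall
  have hyp : ∀ x ∈ Ioo (g / 2) b, CutoffQuadHyp P Ω k B c N C lam x := fun x hx =>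
    hb.mono (ha0.trans hx.1) hx.2.le
  have hmono : ∀ x ∈ Ioo (g / 2) b, ∀ n, gbar P.β x n ≤ gbar P.β b n := fun x hx n =>
    hGb.gbar_mono_init hsmall n (ha0.trans hx.1) hx.2.le le_rfl
  have hA0 := zbarTerm2ConstA_nonneg hB hC hC20
  have hA'0 := zbarTerm2ConstA'_nonneg hB hC hC20
  set A : ℝ := zbarTerm2ConstA B C ((1 + N) / c + N + 2 * Ω / (Ω - 1)) with hA
  set A' : ℝ := zbarTerm2ConstA' B C ((1 + N) / c + N + 2 * Ω / (Ω - 1)) with hA'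
  obtain ⟨hs2, -⟩ := hGb.summable_weight_mul_gbar_sq j
  obtain ⟨hs3, -⟩ := hGb.tsum_weight_mul_gbar_cube_le j
  set M : ℝ := A * (cutoffWeight Ω k j * gbar P.β b j) / (g / 2) ^ 3 with hM
  set M' : ℝ := A' / (g / 2) ^ 3 with hM'
  have hu_sum : Summable fun l => M * (cutoffWeight Ω k (l + j) * gbar P.β b (l + j) ^ 2) +
      M' * (cutoffWeight Ω k (l + j) * gbar P.β b (l + j) ^ 3) :=
    (hs2.mul_left M).add (hs3.mul_left M')
  -- summability of the differentiated series at `g` (its terms are bounded by the first-order majorant)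
  have hsum0 : Summable fun l => P.zbarDerivTerm g j l := by
    have hgq := hb.mono hg hgb.le
    have hGg := hgq.toCutoffGbarHyp
    obtain ⟨hs2g, -⟩ := hGg.summable_weight_mul_gbar_sq j
    obtain ⟨hs3g, -⟩ := hGg.tsum_weight_mul_gbar_cube_le j
    refine Summable.of_norm_bounded
      ((hs2g.mul_left (4 * C ^ 2 * ((1 + N) / c + N + 2 * Ω / (Ω - 1)) *
        (cutoffWeight Ω k j * gbar P.β g j) / g ^ 2)).add (hs3g.mul_left (4 * C / g ^ 2))) fun l => ?_
    rw [Real.norm_eq_abs]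
    refine (hgq.abs_zbarDerivTerm_le (hsm g hgb.le) j l).trans (le_of_eq ?_)
    ring
  refine hasDerivAt_tsum_of_isPreconnected (t := Ioo (g / 2) b) (y₀ := g) hu_sum isOpen_Ioo
    isPreconnected_Ioo (fun l x hx => hasDerivAt_zbarDerivTerm P (hyp x hx).one_sub_zeta_mul_gbar_ne_zero j l)
    (fun l x hx => ?_) ⟨by linarith, hgb⟩ hsum0 ⟨by linarith, hgb⟩
  have hx0 : 0 < x := ha0.trans hx.1
  have hGx := (hyp x hx).toCutoffGbarHyp
  have hwj := (hGx.weight_pos j).le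
  have hwl := (hGx.weight_pos (l + j)).le
  have hgj := (hGx.gbar_pos j).le
  have hgl := (hGx.gbar_pos (l + j)).le
  have hnum := zbarMajorant2_mono hA0 hA'0 hwj hwl hgj hgl (hmono x hx j) (hmono x hx (l + j))
  have hnn : 0 ≤ A * (cutoffWeight Ω k j * gbar P.β b j) * (cutoffWeight Ω k (l + j) * gbar P.β b (l + j) ^ 2) +
      A' * (cutoffWeight Ω k (l + j) * gbar P.β b (l + j) ^ 3) := le_trans (by positivity) hnum
  have hx3 : (g / 2) ^ 3 ≤ x ^ 3 := pow_le_pow_left₀ ha0.le hx.1.le 3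
  rw [Real.norm_eq_abs]
  calc |P.zbarDerivTerm2 x j l|
      ≤ (A * (cutoffWeight Ω k j * gbar P.β x j) * (cutoffWeight Ω k (l + j) * gbar P.β x (l + j) ^ 2) +
          A' * (cutoffWeight Ω k (l + j) * gbar P.β x (l + j) ^ 3)) / x ^ 3 :=
        (hyp x hx).abs_zbarDerivTerm2_le (hsm x hx.2.le) j l
    _ ≤ (A * (cutoffWeight Ω k j * gbar P.β b j) * (cutoffWeight Ω k (l + j) * gbar P.β b (l + j) ^ 2) +
          A' * (cutoffWeight Ω k (l + j) * gbar P.β b (l + j) ^ 3)) / x ^ 3 :=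
        div_le_div_of_nonneg_right hnum (by positivity)
    _ ≤ (A * (cutoffWeight Ω k j * gbar P.β b j) * (cutoffWeight Ω k (l + j) * gbar P.β b (l + j) ^ 2) +
          A' * (cutoffWeight Ω k (l + j) * gbar P.β b (l + j) ^ 3)) / (g / 2) ^ 3 :=
        div_le_div_of_nonneg_left hnn (by positivity) hx3
    _ = M * (cutoffWeight Ω k (l + j) * gbar P.β b (l + j) ^ 2) +
          M' * (cutoffWeight Ω k (l + j) * gbar P.β b (l + j) ^ 3) := by
        rw [hM, hM']
        ring

/-- **[BBS-rg-flow, Lemma 2.3, (2.34) for `z̄`]: `|z̄_j''| ≤ K_{z,2}χ_jḡ_j²/g₀³`** ("`z̄_j'' = O(χ_jḡ_j²/ḡ₀³)`").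
[cite: BauerschmidtBrydgesSlade2015Flow, Lemma 2.3, (2.34)] -/
theorem CutoffQuadHyp.abs_zbarDeriv2_le {g₀ : ℝ} (h : CutoffQuadHyp P Ω k B c N C lam g₀)
    (hsmall : 8 * B ^ 2 * ((1 + N) / c + N + 2 * Ω / (Ω - 1)) * g₀ ≤ 1) (j : ℕ) :
    |P.zbarDeriv2 g₀ j| ≤ zbarDeriv2Const B C ((1 + N) / c + N + 2 * Ω / (Ω - 1)) *
      (cutoffWeight Ω k j * gbar P.β g₀ j ^ 2) / g₀ ^ 3 := by
  have hG := h.toCutoffGbarHyp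
  have hg := hG.g₀_pos
  have hC := h.C_nonneg
  have hB := hG.B_nonneg
  have hC20 := hG.C20_nonneg
  obtain ⟨hs2, ht2⟩ := hG.summable_weight_mul_gbar_sq j
  obtain ⟨hs3, ht3⟩ := hG.tsum_weight_mul_gbar_cube_le j
  have hwj := (hG.weight_pos j).le
  have hwj1 := hG.weight_le_one j
  have hgj := (hG.gbar_pos j).le
  have hle0 : ∀ l, |P.zbarDerivTerm2 g₀ j l| ≤ _ := fun l => h.abs_zbarDerivTerm2_le hsmall j l
  set c20 : ℝ := (1 + N) / c + N + 2 * Ω / (Ω - 1) with hc20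
  have hA0 := zbarTerm2ConstA_nonneg hB hC hC20
  have hA'0 := zbarTerm2ConstA'_nonneg hB hC hC20
  set A : ℝ := zbarTerm2ConstA B C c20 with hA
  set A' : ℝ := zbarTerm2ConstA' B C c20 with hA'
  set M : ℝ := A * (cutoffWeight Ω k j * gbar P.β g₀ j) / g₀ ^ 3 with hM
  set M' : ℝ := A' / g₀ ^ 3 with hM'
  have hM0 : 0 ≤ M := by positivity
  have hM'0 : 0 ≤ M' := by positivity
  set v : ℕ → ℝ := fun l => M * (cutoffWeight Ω k (l + j) * gbar P.β g₀ (l + j) ^ 2) +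
    M' * (cutoffWeight Ω k (l + j) * gbar P.β g₀ (l + j) ^ 3) with hv
  have hv_sum : Summable v := (hs2.mul_left M).add (hs3.mul_left M')
  have hle : ∀ l, |P.zbarDerivTerm2 g₀ j l| ≤ v l := fun l => by
    refine (hle0 l).trans (le_of_eq ?_)
    rw [hv, hM, hM']
    ring
  have hsum : Summable fun l => P.zbarDerivTerm2 g₀ j l :=
    Summable.of_norm_bounded hv_sum fun l => by rw [Real.norm_eq_abs]; exact hle l
  calc |P.zbarDeriv2 g₀ j| ≤ ∑' l, |P.zbarDerivTerm2 g₀ j l| := by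
        have := norm_tsum_le_tsum_norm (f := fun l => P.zbarDerivTerm2 g₀ j l)
          (by simpa only [Real.norm_eq_abs] using hsum.abs)
        simpa only [QuadFlowParams.zbarDeriv2, Real.norm_eq_abs] using this
    _ ≤ ∑' l, v l := Summable.tsum_le_tsum hle hsum.abs hv_sum
    _ = M * ∑' l, cutoffWeight Ω k (l + j) * gbar P.β g₀ (l + j) ^ 2 +
          M' * ∑' l, cutoffWeight Ω k (l + j) * gbar P.β g₀ (l + j) ^ 3 := by
        rw [hv, (hs2.mul_left M).tsum_add (hs3.mul_left M'), tsum_mul_left, tsum_mul_left]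
    _ ≤ M * (c20 * (cutoffWeight Ω k j * gbar P.β g₀ j)) + M' * (2 * c20 * (cutoffWeight Ω k j * gbar P.β g₀ j ^ 2)) :=
        add_le_add (mul_le_mul_of_nonneg_left ht2 hM0) (mul_le_mul_of_nonneg_left ht3 hM'0)
    _ = (A * c20 * cutoffWeight Ω k j + 2 * A' * c20) * (cutoffWeight Ω k j * gbar P.β g₀ j ^ 2) / g₀ ^ 3 := by
        rw [hM, hM']
        field_simp
    _ ≤ (A * c20 + 2 * A' * c20) * (cutoffWeight Ω k j * gbar P.β g₀ j ^ 2) / g₀ ^ 3 := by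
        refine div_le_div_of_nonneg_right (mul_le_mul_of_nonneg_right ?_ (by positivity)) (by positivity)
        nlinarith [mul_nonneg (mul_nonneg hA0 hC20) (sub_nonneg.2 hwj1)]
    _ = _ := by rw [zbarDeriv2Const, hA, hA']

end

end CTWSAW

end Literature.Barriers.CriticalPhenomena
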